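import Literature.AnabelianGeometry.SemiGraphs.UniversalCoveringOverRigid

/-!
# `Aut(𝒢_{∞,S})` is countable ([SemiAnbd] §3 p. 38) — proofs

Proof-only sequel to `UniversalCoveringOverRigid.lean`: by rigidity, evaluation at a point of a
vertex fibre (or of an edge fibre) is injective on morphisms `𝒢_{∞,S} ⟶ X`; since the fibres of
objects of `B^cov(𝒢)` are countable, `Hom(𝒢_{∞,S}, X)` and `Aut(𝒢_{∞,S})` are countable — the
groups `Gal(𝒢_{∞,i}/𝒢)` of [SemiAnbd] p. 38 are countable discrete groups, as required for the
tempered (countably prodiscrete) limit `π₁^temp(𝒢) = lim_i Gal(𝒢_{∞,i}/𝒢)`.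
-/

namespace Literature.AnabelianGeometry.SemiGraphs

namespace ProfiniteSemiGraph

open CategoryTheory

universe u

variable {𝒢 : ProfiniteSemiGraph.{u}} (S : CovObj 𝒢) (c : S.orbitGraph.CatCarrier)
  (h𝒢 : 𝒢.IsCountable) {X : CovObj 𝒢}

/-- Agreement on an edge-orbit spreads along the `Π_e`-orbit: it suffices to check one point.
[cite: MochizukiSemiAnbd2006, Prop 3.6 p.38] -/
theorem CovObj.agreeAt_inr_of_one (φ ψ : S.univCoverOver c h𝒢 ⟶ X) (E : S.OEdge)
    (q : S.orbitGraph.basept c ⟶ S.orbitGraph.basept (Sum.inr E))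
    (y₀ : (S.SE (CovObj.OEdge.base S E)).obj.V) (hy₀ : Quot.mk S.ERel ⟨_, y₀⟩ = E)
    (h₀ : (φ.fE _).hom.hom (⟨⟨E, rfl⟩, ⟨⟨y₀, hy₀⟩, q⟩⟩ : S.FibE c (CovObj.OEdge.base S E)) =
      (ψ.fE _).hom.hom (⟨⟨E, rfl⟩, ⟨⟨y₀, hy₀⟩, q⟩⟩ : S.FibE c (CovObj.OEdge.base S E))) :
    CovObj.AgreeAt S c h𝒢 φ ψ (S.orbitGraph.basept (Sum.inr E)) q := by
  intro y hy
  obtain ⟨g, hg⟩ := S.exists_ρE_of_mk_eq_mk (hy₀.trans hy.symm)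
  have ht : (⟨⟨E, rfl⟩, ⟨⟨y, hy⟩, q⟩⟩ : S.FibE c (CovObj.OEdge.base S E)) =
      S.fibEAct c _ g ⟨⟨E, rfl⟩, ⟨⟨y₀, hy₀⟩, q⟩⟩ :=
    CovObj.FibE.ext S c rfl hg.symm HEq.rfl
  rw [ht]
  exact (CovHom.fE_ρ φ _ g _).trans ((congrArg _ h₀).trans (CovHom.fE_ρ ψ _ g _).symm)

/-- **Rigidity, edge form**: two morphisms `𝒢_{∞,S} ⟶ X` which agree at one point of one EDGE
fibre are equal. [cite: MochizukiSemiAnbd2006, Prop 3.6 p.38] -/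
theorem CovObj.univCoverOver_hom_ext_edge (φ ψ : S.univCoverOver c h𝒢 ⟶ X) {e₀ : 𝒢.graph.Edge}
    (t₀ : S.FibE c e₀) (h₀ : (φ.fE e₀).hom.hom t₀ = (ψ.fE e₀).hom.hom t₀) : φ = ψ := by
  cases t₀ with | mk E₀' yq =>
  cases yq with | mk yy q₀ =>
  cases yy with | mk y₀ hy₀ =>
  cases E₀' with | mk E₀ hE₀ =>
  change CovObj.OEdge.base S E₀ = e₀ at hE₀
  subst hE₀
  have base : CovObj.AgreeAt S c h𝒢 φ ψ (S.orbitGraph.basept (Sum.inr E₀)) q₀ :=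
    S.agreeAt_inr_of_one c h𝒢 φ ψ E₀ q₀ y₀ hy₀ h₀
  refine CovHom.ext (funext fun v => ?_) (funext fun e => ?_)
  · apply ObjectProperty.hom_ext
    apply Action.Hom.ext
    apply ConcreteCategory.hom_ext
    intro t
    cases t with | mk V' xq =>
    cases xq with | mk xx' p =>
    cases xx' with | mk x hx =>
    cases V' with | mk V hV =>
    change CovObj.OVertex.base S V = v at hV
    subst hV
    have hA := S.agreeAt_transport c h𝒢 φ ψ (inv q₀ ≫ p) q₀ base
    have e : q₀ ≫ (inv q₀ ≫ p) = p := by rw [← Category.assoc, IsIso.hom_inv_id, Category.id_comp]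
    rw [e] at hA
    exact hA x hx
  · apply ObjectProperty.hom_ext
    apply Action.Hom.ext
    apply ConcreteCategory.hom_ext
    intro t
    cases t with | mk E' yq =>
    cases yq with | mk yy q =>
    cases yy with | mk y hy =>
    cases E' with | mk E hE =>
    change CovObj.OEdge.base S E = e at hE
    subst hE
    have hA := S.agreeAt_transport c h𝒢 φ ψ (inv q₀ ≫ q) q₀ base
    have e : q₀ ≫ (inv q₀ ≫ q) = q := by rw [← Category.assoc, IsIso.hom_inv_id, Category.id_comp]
    rw [e] at hA
    exact hA y hy

/-- Evaluation at a point of a vertex fibre is injective on morphisms out of `𝒢_{∞,S}`.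
[cite: MochizukiSemiAnbd2006, Prop 3.6 p.38] -/
theorem CovObj.univCoverOver_eval_injective {v₀ : 𝒢.graph.Vertex} (t₀ : S.FibV c v₀) :
    Function.Injective (fun φ : S.univCoverOver c h𝒢 ⟶ X => (φ.fV v₀).hom.hom t₀) :=
  fun φ ψ h => S.univCoverOver_hom_ext c h𝒢 φ ψ t₀ h

/-- **`Hom(𝒢_{∞,S}, X)` is countable** (given a point of a vertex fibre of `𝒢_{∞,S}`; the fibres of
`X` are countable). [cite: MochizukiSemiAnbd2006, Prop 3.6 p.38] -/
theorem CovObj.countable_hom_univCoverOver {v₀ : 𝒢.graph.Vertex} (t₀ : S.FibV c v₀) :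
    Countable (S.univCoverOver c h𝒢 ⟶ X) := by
  haveI : Countable (X.SV v₀).obj.V := (X.SV v₀).property.1
  exact (S.univCoverOver_eval_injective c h𝒢 (X := X) t₀).countable

/-- **`Aut(𝒢_{∞,S})` is countable** ("`Gal(𝒢_{∞,i}/𝒢)`", [SemiAnbd] p. 38, is a countable discrete
group). [cite: MochizukiSemiAnbd2006, Prop 3.6 p.38] -/
theorem CovObj.countable_aut_univCoverOver {v₀ : 𝒢.graph.Vertex} (t₀ : S.FibV c v₀) :
    Countable (Aut (S.univCoverOver c h𝒢)) := by
  haveI := S.countable_hom_univCoverOver c h𝒢 (X := S.univCoverOver c h𝒢) t₀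
  exact Function.Injective.countable (f := fun σ : Aut (S.univCoverOver c h𝒢) => σ.hom)
    fun σ τ h => Iso.ext h

/-- The base vertex fibre of `𝒢_{∞,S}` based at a vertex-orbit `V₀` has a canonical point
`(V₀, x₀, 𝟙)` for every point `x₀` of `V₀`. [cite: MochizukiSemiAnbd2006, Prop 3.6 p.38] -/
theorem CovObj.nonempty_fibV_base (V₀ : S.OVertex) :
    Nonempty (S.FibV (Sum.inl V₀) (CovObj.OVertex.base S V₀)) := by
  obtain ⟨x₀, hx₀⟩ := CovObj.OVertex.exists_rep S V₀
  exact ⟨⟨⟨V₀, rfl⟩, ⟨⟨x₀, hx₀⟩, 𝟙 _⟩⟩⟩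

end ProfiniteSemiGraph

end Literature.AnabelianGeometry.SemiGraphs
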